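import Summits.HodgeConjecture.HodgeConjecture.Theorems.CyclicUnitaryPowersNodalMeridianMonodromy
import HarnessLib

/-!
# K1-A stub `stub_localMonodromyBound` — LANDED (route `CyclicUnitaryPowers`, crux stmt-HodgeConjecture-19544)

Prover seat `hodge-nonav-prover-Ax` (g10), cell `hodge-nonav`. The registered stub `stub_localMonodromyBound` of the crux skeleton of
`VeryGeneralDeckCommutatorsInHg` — the Picard–Lefschetz binder F1‡
`Literature.AlgebraicGeometry.HodgeTheory.carlsonToledo1999_nodalMeridianLocalMonodromyBound` (Carlson–Toledo 1999 §6 (kdoublept),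
bound form) — proved BY NAME from `carlsonToledo1999_nodalMeridianLocalMonodromyBound_holds` (programme "localisation": the geometric
monodromy of the nodal pencil). Sorry-free; no definition, no new named fact; nothing here says HC ∕ HC_AV is proved (the crux stays
conditional on the remaining stub `stub_cdkCover`).

## References

* [CarlsonToledo1999] J. A. Carlson, D. Toledo, Duke Math. J. 97 (1999), §6 (kdoublept) (held text p0013–p0014).
-/

set_option linter.dupNamespace false

noncomputable section

namespace Summit.HodgeConjecture.HodgeConjecture.Theorems.CyclicUnitaryPowersVeryGeneralDeckCommutatorsInHgStubLocalMonodromyBound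

/-- **Stub `stub_localMonodromyBound` of crux K1-A, proved**: the nodal-meridian local-monodromy bound F1‡.
[cite: CarlsonToledo1999, §6 (kdoublept) (held text p0013–p0014)] -/
theorem stub_localMonodromyBound : Literature.AlgebraicGeometry.HodgeTheory.carlsonToledo1999_nodalMeridianLocalMonodromyBound :=
  CyclicUnitaryPowersNodalMeridianMonodromy.carlsonToledo1999_nodalMeridianLocalMonodromyBound_holds

end Summit.HodgeConjecture.HodgeConjecture.Theorems.CyclicUnitaryPowersVeryGeneralDeckCommutatorsInHgStubLocalMonodromyBound

end
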